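import Summits.CriticalPhenomena.PercolationContinuityZ3.Theorems.FK.InfiniteVolumeDLRDefs
import Summits.CriticalPhenomena.PercolationContinuityZ3.Theorems.FK.InfiniteVolumeOutsideSandwich
import Literature.Probability.Percolation.PercolationProofs
import HarnessLib

/-!
# FK-continuity transplant, FO-06 (construction half): the random-cluster specification kernel —
# cluster-count combinatorics, dependence on the induced boundary partition only, measurability

Cell `fk-continuity` (bschramm), row FO-06b-6; support file for the FK-continuity transplant
(`--supports stmt-CriticalPhenomena-4575`); builds on p205010 (kernel theorem, internal audit signed;
external expert review pending). Pure proofs about the definitions of `InfiniteVolumeDLRDefs.lean`; no named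
facts, no sorries, standard axioms.

* `meetClusterCount` (`k(ω, Λ)`, the number of open clusters meeting `Λ`) depends on `ω` only through the
  connection relation it induces on `Λ` (`meetClusterCount_congr`, and across vertex types
  `ncard_image_connectedComponentMk_congr`); `k ≤ |Λ|`.
* **Exchange identity** (the combinatorial heart of Grimmett's Lemma (4.13)): in a finite graph with a wired
  set `W`, for two inside patterns `ω₁, ω₂` (edges with both endpoints in `Λ`) over the same outside
  configuration `ζ`, `k^W(ω₁ ∪ ζ) + k_Λ(ω₂ ∪ ζ) = k^W(ω₂ ∪ ζ) + k_Λ(ω₁ ∪ ζ)` — the clusters NOT meeting `Λ`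
  are the same (`clusterCount_add_ncard_image_eq`).
* The kernel `rcCondProb p q Λ ξ η` is a probability vector in `η ⊆ E_Λ` (`0 ≤ p ≤ 1`, `q > 0`), depends on
  `ξ` only through `ξ ∖ E_Λ` and indeed only through the partition of `Λ` induced by `ξ ∖ E_Λ`
  (`rcCondProb_congr_of_forall_reachable_iff`), and is measurable in `ξ` for the outside σ-algebra
  `𝒯_Λ = cylinderEvents (E_Λ)ᶜ` (`measurable_rcCondProb_cylinderEvents`).

## References

* G. Grimmett, *The Random-Cluster Model*, Springer 2006: §4.2 (4.11)–(4.13), Lemma (4.13) (proof,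
  p. 71: "k(ω, Λ) differs from the total cluster count by a term not depending on the configuration
  inside Λ"). [Grimmett2006]
-/

noncomputable section

open MeasureTheory Set Filter
open scoped Topology ENNReal

namespace Summit.CriticalPhenomena.PercolationContinuityZ3.Theorems.FK

open Literature.Probability.Percolation Literature.Probability.LatticeModels

/-! ### Counting classes: images with the same kernel have the same size -/

section Counting

/-- Two maps that identify the same pairs of points of `S` have images of the same size. [folklore] -/
theorem ncard_image_eq_of_forall_iff {α β γ : Type*} (f : α → β) (g : α → γ) (S : Set α)
    (h : ∀ a ∈ S, ∀ b ∈ S, (f a = f b ↔ g a = g b)) : (f '' S).ncard = (g '' S).ncard := by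
  classical
  refine Set.ncard_congr (fun x hx => g hx.choose) ?_ ?_ ?_
  · rintro x ⟨a, ha, rfl⟩
    exact ⟨_, (Exists.choose_spec (⟨a, ha, rfl⟩ : f a ∈ f '' S)).1, rfl⟩
  · intro x y hx hy hxy
    have hx' := hx.choose_spec
    have hy' := hy.choose_spec
    rw [← hx'.2, ← hy'.2]
    exact (h _ hx'.1 _ hy'.1).2 hxy
  · rintro _ ⟨a, ha, rfl⟩
    refine ⟨f a, ⟨a, ha, rfl⟩, ?_⟩
    have h' := (Exists.choose_spec (⟨a, ha, rfl⟩ : f a ∈ f '' S))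
    exact (h _ h'.1 _ ha).1 h'.2

variable {V V₁ V₂ α : Type*}

/-- **The number of clusters hit depends only on the induced connection relation**: if two graphs (on
possibly different vertex types) connect the points `i₁ a, i₁ b` exactly when they connect `i₂ a, i₂ b`
(`a, b ∈ S`), they have the same number of connected components meeting the image of `S`. [folklore] -/
theorem ncard_image_connectedComponentMk_congr (G₁ : SimpleGraph V₁) (G₂ : SimpleGraph V₂) (i₁ : α → V₁)
    (i₂ : α → V₂) (S : Set α)
    (h : ∀ a ∈ S, ∀ b ∈ S, (G₁.Reachable (i₁ a) (i₁ b) ↔ G₂.Reachable (i₂ a) (i₂ b))) :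
    ((fun a => G₁.connectedComponentMk (i₁ a)) '' S).ncard =
      ((fun a => G₂.connectedComponentMk (i₂ a)) '' S).ncard :=
  ncard_image_eq_of_forall_iff _ _ S fun a ha b hb => by
    rw [SimpleGraph.ConnectedComponent.eq, SimpleGraph.ConnectedComponent.eq]; exact h a ha b hb

/-- `k(ω, S)` depends on `ω` only through the connection relation on `S`. [cite: Grimmett2006, §4.2 (4.12)] -/
theorem meetClusterCount_congr {ω ω' : BondConfig V} {S : Set V}
    (h : ∀ u ∈ S, ∀ v ∈ S, ((openGraph ω).Reachable u v ↔ (openGraph ω').Reachable u v)) :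
    meetClusterCount ω S = meetClusterCount ω' S := by
  rw [meetClusterCount_eq, meetClusterCount_eq]
  exact ncard_image_connectedComponentMk_congr _ _ id id S h

/-- `k(ω, Λ) ≤ |Λ|`. [cite: Grimmett2006, §4.2 (4.12)] -/
theorem meetClusterCount_le_card (ω : BondConfig V) (Λ : Finset V) :
    meetClusterCount ω ↑Λ ≤ Λ.card := by
  rw [meetClusterCount_eq, ← Set.ncard_coe_finset Λ]
  exact Set.ncard_image_le Λ.finite_toSet

end Counting

/-! ### The exchange identity: clusters not meeting `Λ` do not see the configuration inside `Λ` -/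

section Exchange

variable {V : Type*}

/-- If `G` only adds to `G₀` edges with both endpoints in `Λ'`, a vertex not joined in `G₀` to `Λ'` is joined
in `G` to nothing new. [folklore] -/
theorem reachable_of_le_of_forall_not_reachable {G₀ G : SimpleGraph V} {Λ' : Set V}
    (hnew : ∀ a b, G.Adj a b → ¬ G₀.Adj a b → a ∈ Λ' ∧ b ∈ Λ') {v : V}
    (hv : ∀ u ∈ Λ', ¬ G₀.Reachable v u) {x : V} (hx : G.Reachable v x) : G₀.Reachable v x := by
  classical
  by_contra hnot
  obtain ⟨w⟩ := hx
  obtain ⟨e, -, h₁, h₂⟩ := w.exists_boundary_dart {y | G₀.Reachable v y} (SimpleGraph.Reachable.refl v) hnot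
  by_cases h₀ : G₀.Adj e.toProd.1 e.toProd.2
  · exact h₂ (SimpleGraph.Reachable.trans h₁ h₀.reachable)
  · exact hv _ (hnew _ _ e.adj h₀).1 h₁

/-- **The components avoiding `Λ'` are the same** for `G₀ ≤ G` when every new edge of `G` has both endpoints
in `Λ'`. [cite: Grimmett2006, Lemma (4.13) (proof)] -/
theorem ncard_compl_image_connectedComponentMk_eq_of_le {G₀ G : SimpleGraph V} (hle : G₀ ≤ G) {Λ' : Set V}
    (hnew : ∀ a b, G.Adj a b → ¬ G₀.Adj a b → a ∈ Λ' ∧ b ∈ Λ') :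
    ((G₀.connectedComponentMk '' Λ')ᶜ).ncard = ((G.connectedComponentMk '' Λ')ᶜ).ncard := by
  classical
  -- a component of `G₀` avoiding `Λ'`, represented by `v`, is not joined in `G₀` to `Λ'`
  have key : ∀ v : V, G₀.connectedComponentMk v ∉ G₀.connectedComponentMk '' Λ' →
      ∀ u ∈ Λ', ¬ G₀.Reachable v u := by
    intro v hv u hu hr
    exact hv ⟨u, hu, (SimpleGraph.ConnectedComponent.eq.2 hr).symm⟩
  refine Set.ncard_congr (fun c _ => c.map (SimpleGraph.Hom.ofLE hle)) ?_ ?_ ?_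
  · intro c hc
    induction c using SimpleGraph.ConnectedComponent.ind with
    | h v =>
      rintro ⟨u, hu, huv⟩
      rw [SimpleGraph.ConnectedComponent.map_mk, SimpleGraph.ConnectedComponent.eq] at huv
      have h' := reachable_of_le_of_forall_not_reachable hnew (key v hc) huv.symm
      exact key v hc u hu h'
  · intro c c' hc hc'
    induction c using SimpleGraph.ConnectedComponent.ind with
    | h v =>
      induction c' using SimpleGraph.ConnectedComponent.ind with
      | h v' =>
        intro h
        rw [SimpleGraph.ConnectedComponent.map_mk, SimpleGraph.ConnectedComponent.map_mk,
          SimpleGraph.ConnectedComponent.eq] at h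
        exact SimpleGraph.ConnectedComponent.eq.2
          (reachable_of_le_of_forall_not_reachable hnew (key v hc) h)
  · intro c hc
    induction c using SimpleGraph.ConnectedComponent.ind with
    | h v =>
      refine ⟨G₀.connectedComponentMk v, ?_, by rw [SimpleGraph.ConnectedComponent.map_mk]; rfl⟩
      rintro ⟨u, hu, huv⟩
      rw [SimpleGraph.ConnectedComponent.eq] at huv
      exact hc ⟨u, hu, SimpleGraph.ConnectedComponent.eq.2 (huv.mono hle)⟩

/-- An edge set all of whose pairs have both endpoints in `Λ'` ("inside patterns"). [cite: Grimmett2006, §4.2 (E_Λ)] -/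
theorem openGraph_union_adj_of_not {ω ζ : BondConfig V} {W Λ' : Set V} (hω : ∀ e ∈ ω, ∀ v ∈ e, v ∈ Λ')
    {a b : V} (h : (openGraph (ω ∪ ζ) ⊔ wired W).Adj a b) (h₀ : ¬ (openGraph ζ ⊔ wired W).Adj a b) :
    a ∈ Λ' ∧ b ∈ Λ' := by
  rw [SimpleGraph.sup_adj, openGraph_adj] at h h₀
  rcases h with ⟨hab, hne⟩ | hw
  · rcases hab with hab | hab
    · exact ⟨hω _ hab a (Sym2.mem_mk_left a b), hω _ hab b (Sym2.mem_mk_right a b)⟩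
    · exact (h₀ (Or.inl ⟨hab, hne⟩)).elim
  · exact (h₀ (Or.inr hw)).elim

/-- `⟨ζ⟩ ∨ K_W ≤ ⟨ω ∪ ζ⟩ ∨ K_W`. [folklore] -/
theorem openGraph_sup_wired_le_union (ω ζ : BondConfig V) (W : Set V) :
    openGraph ζ ⊔ wired W ≤ openGraph (ω ∪ ζ) ⊔ wired W :=
  sup_le_sup_right (openGraph_mono Set.subset_union_right) _

/-- **Exchange identity** (Grimmett 2006, proof of Lemma (4.13)): on a finite graph with wired set `W`, for
inside patterns `ω₁, ω₂` (all endpoints in `Λ'`) over a common configuration `ζ`,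
`k^W(ω₁ ∪ ζ) + #{clusters of ⟨ω₂ ∪ ζ⟩ ∨ K_W meeting Λ'} = k^W(ω₂ ∪ ζ) + #{clusters of ⟨ω₁ ∪ ζ⟩ ∨ K_W meeting Λ'}`:
the total cluster count exceeds the count of clusters meeting `Λ'` by a quantity not depending on the
pattern inside `Λ'`. [cite: Grimmett2006, Lemma (4.13) (proof)] -/
theorem clusterCount_add_ncard_image_eq [Finite V] {ω₁ ω₂ ζ : BondConfig V} {W Λ' : Set V}
    (hω₁ : ∀ e ∈ ω₁, ∀ v ∈ e, v ∈ Λ') (hω₂ : ∀ e ∈ ω₂, ∀ v ∈ e, v ∈ Λ') :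
    clusterCount (ω₁ ∪ ζ) W + ((openGraph (ω₂ ∪ ζ) ⊔ wired W).connectedComponentMk '' Λ').ncard =
      clusterCount (ω₂ ∪ ζ) W + ((openGraph (ω₁ ∪ ζ) ⊔ wired W).connectedComponentMk '' Λ').ncard := by
  have h₁ := Set.ncard_add_ncard_compl ((openGraph (ω₁ ∪ ζ) ⊔ wired W).connectedComponentMk '' Λ')
  have h₂ := Set.ncard_add_ncard_compl ((openGraph (ω₂ ∪ ζ) ⊔ wired W).connectedComponentMk '' Λ')
  have e₁ := ncard_compl_image_connectedComponentMk_eq_of_le (openGraph_sup_wired_le_union ω₁ ζ W)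
    (Λ' := Λ') (fun a b h h₀ => openGraph_union_adj_of_not hω₁ h h₀)
  have e₂ := ncard_compl_image_connectedComponentMk_eq_of_le (openGraph_sup_wired_le_union ω₂ ζ W)
    (Λ' := Λ') (fun a b h h₀ => openGraph_union_adj_of_not hω₂ h h₀)
  simp only [clusterCount]
  omega

end Exchange

/-! ### The kernel is a probability vector -/

section Kernel

variable {d : ℕ} {p q : ℝ}

/-- Weights are nonnegative (`0 ≤ p ≤ 1`, `q ≥ 0`). [cite: Grimmett2006, §4.2 (4.12)] -/
theorem rcCondWeight_nonneg (hp : p ∈ Set.Icc (0 : ℝ) 1) (hq : 0 ≤ q) (Λ : Finset (Site d))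
    (ξ : BondConfig (Site d)) (η : Finset (Sym2 (Site d))) : 0 ≤ rcCondWeight p q Λ ξ η := by
  have h1 : 0 ≤ 1 - p := sub_nonneg.2 hp.2
  have h0 : 0 ≤ p := hp.1
  rw [rcCondWeight_eq]
  positivity

/-- The normalisation is positive (`0 ≤ p ≤ 1`, `q > 0`): the empty pattern (if `p < 1`) or the full pattern
(if `p > 0`) has positive weight. [cite: Grimmett2006, §4.2 (4.12)] -/
theorem rcCondPartition_pos (hp : p ∈ Set.Icc (0 : ℝ) 1) (hq : 0 < q) (Λ : Finset (Site d))
    (ξ : BondConfig (Site d)) : 0 < rcCondPartition p q Λ ξ := by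
  rw [rcCondPartition_eq]
  refine Finset.sum_pos' (fun η _ => rcCondWeight_nonneg hp hq.le Λ ξ η) ?_
  rcases hp.1.eq_or_lt with h | h
  · refine ⟨∅, Finset.empty_mem_powerset _, ?_⟩
    rw [rcCondWeight_eq, ← h]
    simp only [Finset.card_empty, pow_zero, sub_zero, one_pow, one_mul]
    positivity
  · refine ⟨edgesIn (zdGraph d) Λ, Finset.mem_powerset_self _, ?_⟩
    rw [rcCondWeight_eq, Finset.sdiff_self, Finset.card_empty, pow_zero, mul_one]
    positivity

/-- The kernel is nonnegative. [cite: Grimmett2006, §4.2 (4.12)] -/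
theorem rcCondProb_nonneg (hp : p ∈ Set.Icc (0 : ℝ) 1) (hq : 0 < q) (Λ : Finset (Site d))
    (ξ : BondConfig (Site d)) (η : Finset (Sym2 (Site d))) : 0 ≤ rcCondProb p q Λ ξ η := by
  rw [rcCondProb_eq]
  exact div_nonneg (rcCondWeight_nonneg hp hq.le Λ ξ η) (rcCondPartition_pos hp hq Λ ξ).le

/-- **The kernel is a probability vector** on the inside patterns `η ⊆ E_Λ`. [cite: Grimmett2006, §4.2 (4.12)] -/
theorem sum_rcCondProb_eq_one (hp : p ∈ Set.Icc (0 : ℝ) 1) (hq : 0 < q) (Λ : Finset (Site d))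
    (ξ : BondConfig (Site d)) :
    ∑ η ∈ (edgesIn (zdGraph d) Λ).powerset, rcCondProb p q Λ ξ η = 1 := by
  simp only [rcCondProb_eq]
  rw [← Finset.sum_div, ← rcCondPartition_eq, div_self (rcCondPartition_pos hp hq Λ ξ).ne']

/-- Each kernel entry is at most `1`. [cite: Grimmett2006, §4.2 (4.12)] -/
theorem rcCondProb_le_one (hp : p ∈ Set.Icc (0 : ℝ) 1) (hq : 0 < q) (Λ : Finset (Site d))
    (ξ : BondConfig (Site d)) {η : Finset (Sym2 (Site d))} (hη : η ⊆ edgesIn (zdGraph d) Λ) :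
    rcCondProb p q Λ ξ η ≤ 1 := by
  rw [← sum_rcCondProb_eq_one hp hq Λ ξ]
  exact Finset.single_le_sum (fun η' _ => rcCondProb_nonneg hp hq Λ ξ η') (Finset.mem_powerset.2 hη)

/-! ### The kernel depends on `ξ` only off `E_Λ`, and only through the induced connections on `Λ` -/

/-- The weight only sees `ξ ∖ E_Λ`. [cite: Grimmett2006, §4.2 (4.12)] -/
theorem rcCondWeight_congr_sdiff {Λ : Finset (Site d)} {ξ ξ' : BondConfig (Site d)}
    (h : ξ \ ↑(edgesIn (zdGraph d) Λ) = ξ' \ ↑(edgesIn (zdGraph d) Λ)) (η : Finset (Sym2 (Site d))) :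
    rcCondWeight p q Λ ξ η = rcCondWeight p q Λ ξ' η := by
  rw [rcCondWeight_eq, rcCondWeight_eq, h]

/-- The kernel only sees `ξ ∖ E_Λ`. [cite: Grimmett2006, §4.2 (4.12)] -/
theorem rcCondProb_congr_sdiff {Λ : Finset (Site d)} {ξ ξ' : BondConfig (Site d)}
    (h : ξ \ ↑(edgesIn (zdGraph d) Λ) = ξ' \ ↑(edgesIn (zdGraph d) Λ)) (η : Finset (Sym2 (Site d))) :
    rcCondProb p q Λ ξ η = rcCondProb p q Λ ξ' η := by
  simp only [rcCondProb_eq, rcCondPartition_eq, rcCondWeight_congr_sdiff h]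

/-- In particular the kernel at `ξ` is the kernel at `ξ ∖ E_Λ`. [cite: Grimmett2006, §4.2 (4.12)] -/
theorem rcCondProb_sdiff (Λ : Finset (Site d)) (ξ : BondConfig (Site d)) (η : Finset (Sym2 (Site d))) :
    rcCondProb p q Λ (ξ \ ↑(edgesIn (zdGraph d) Λ)) η = rcCondProb p q Λ ξ η :=
  rcCondProb_congr_sdiff (by rw [sdiff_sdiff, Set.union_self]) η

/-- **The kernel depends on the boundary condition only through the partition it induces on `Λ`**: if for
every inside pattern `η ⊆ E_Λ` the configurations `η ∪ (ξ ∖ E_Λ)` and `η ∪ (ξ' ∖ E_Λ)` join the same pairs of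
vertices of `Λ`, then `φ^ξ_{Λ,p,q}` and `φ^{ξ'}_{Λ,p,q}` agree. [cite: Grimmett2006, §4.2 (4.12)–(4.13)] -/
theorem rcCondProb_congr_of_forall_reachable_iff {Λ : Finset (Site d)} {ξ ξ' : BondConfig (Site d)}
    (h : ∀ η ⊆ edgesIn (zdGraph d) Λ, ∀ u ∈ Λ, ∀ v ∈ Λ,
      ((openGraph ((↑η : Set (Sym2 (Site d))) ∪ (ξ \ ↑(edgesIn (zdGraph d) Λ)))).Reachable u v ↔
        (openGraph ((↑η : Set (Sym2 (Site d))) ∪ (ξ' \ ↑(edgesIn (zdGraph d) Λ)))).Reachable u v))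
    {η : Finset (Sym2 (Site d))} (hη : η ⊆ edgesIn (zdGraph d) Λ) :
    rcCondProb p q Λ ξ η = rcCondProb p q Λ ξ' η := by
  have hw : ∀ η' ⊆ edgesIn (zdGraph d) Λ, rcCondWeight p q Λ ξ η' = rcCondWeight p q Λ ξ' η' := by
    intro η' hη'
    rw [rcCondWeight_eq, rcCondWeight_eq, meetClusterCount_congr]
    intro u hu v hv
    exact h η' hη' u (Finset.mem_coe.1 hu) v (Finset.mem_coe.1 hv)
  rw [rcCondProb_eq, rcCondProb_eq, hw η hη, rcCondPartition_eq, rcCondPartition_eq,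
    Finset.sum_congr rfl fun η' hη' => hw η' (Finset.mem_powerset.1 hη')]

end Kernel

/-! ### Measurability of the kernel for the outside σ-algebra `𝒯_Λ` -/

section Measurability

variable {d : ℕ}

/-- A `range` form of `ncard_image_eq_of_forall_iff`. [folklore] -/
theorem ncard_range_eq_of_forall_iff {α β γ : Type*} (f : α → β) (g : α → γ)
    (h : ∀ a b, (f a = f b ↔ g a = g b)) : (Set.range f).ncard = (Set.range g).ncard := by
  rw [← Set.image_univ, ← Set.image_univ]
  exact ncard_image_eq_of_forall_iff f g _ fun a _ b _ => h a b

/-- The connection events of `η ∪ (ξ ∖ E_Λ)` are in `𝒯_Λ` (measurable in `ξ` and determined off `E_Λ`). [folklore] -/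
theorem measurableSet_setOf_reachable_union_sdiff (Λ : Finset (Site d)) (η : Finset (Sym2 (Site d)))
    (u v : Site d) :
    MeasurableSet[outsideEvents d Λ]
      {ξ : BondConfig (Site d) |
        (openGraph ((↑η : Set (Sym2 (Site d))) ∪ (ξ \ ↑(edgesIn (zdGraph d) Λ)))).Reachable u v} := by
  have hf : Measurable fun ξ : BondConfig (Site d) =>
      (↑η : Set (Sym2 (Site d))) ∪ (ξ \ ↑(edgesIn (zdGraph d) Λ)) :=
    measurable_set_iff.2 fun e => measurable_const.or ((measurable_set_mem e).and measurable_const)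
  refine measurableSet_cylinderEvents_of_determinedBy ((measurableSet_openConn_holds u v).preimage hf) ?_
  rw [determinedBy_iff]
  intro ω ω' hωω'
  change (openGraph (↑η ∪ (ω \ ↑(edgesIn (zdGraph d) Λ)))).Reachable u v ↔
    (openGraph (↑η ∪ (ω' \ ↑(edgesIn (zdGraph d) Λ)))).Reachable u v
  rw [Set.sdiff_eq, Set.sdiff_eq, hωω']

/-- **`ξ ↦` the weight of `η` under `φ^ξ_{Λ,p,q}` is `𝒯_Λ`-measurable** (a function of the finitely many connection
events between vertices of `Λ`, each in `𝒯_Λ`). [cite: Grimmett2006, §4.4 (4.30) (𝒯_Λ-measurability of φ^ξ_Λ(A))] -/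
theorem measurable_rcCondWeight_outsideEvents (p q : ℝ) (Λ : Finset (Site d)) (η : Finset (Sym2 (Site d))) :
    Measurable[outsideEvents d Λ] fun ξ : BondConfig (Site d) => rcCondWeight p q Λ ξ η := by
  set U : Set (Sym2 (Site d)) := ↑(edgesIn (zdGraph d) Λ) with hU
  -- the vector of connection relations on `Λ`, a measurable map into a finite type
  set Ψ : BondConfig (Site d) → (↥Λ → ↥Λ → Prop) := fun ξ a b =>
    (openGraph ((↑η : Set (Sym2 (Site d))) ∪ (ξ \ U))).Reachable a b with hΨ
  have hΨm : Measurable[outsideEvents d Λ] Ψ := by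
    refine @measurable_pi_lambda (BondConfig (Site d)) ↥Λ (fun _ => ↥Λ → Prop) (outsideEvents d Λ) _ Ψ fun a => ?_
    refine @measurable_pi_lambda (BondConfig (Site d)) ↥Λ (fun _ => Prop) (outsideEvents d Λ) _ (fun ξ => Ψ ξ a)
      fun b => ?_
    exact (@measurableSet_setOf (BondConfig (Site d)) (outsideEvents d Λ) _).1
      (measurableSet_setOf_reachable_union_sdiff Λ η a b)
  -- the cluster count is a function of that vector
  have hk : ∀ ξ, meetClusterCount ((↑η : Set (Sym2 (Site d))) ∪ (ξ \ U)) ↑Λ = (Set.range (Ψ ξ)).ncard := by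
    intro ξ
    have h1 := ncard_image_eq_of_forall_iff
      (openGraph ((↑η : Set (Sym2 (Site d))) ∪ (ξ \ U))).connectedComponentMk
      (fun u : Site d => fun b : ↥Λ => (openGraph ((↑η : Set (Sym2 (Site d))) ∪ (ξ \ U))).Reachable u b)
      (↑Λ : Set (Site d)) fun u _ v hv => by
        rw [SimpleGraph.ConnectedComponent.eq]
        constructor
        · intro huv
          funext b
          exact propext ⟨fun h => huv.symm.trans h, fun h => huv.trans h⟩
        · intro h
          exact (congrFun h ⟨v, hv⟩).mpr (SimpleGraph.Reachable.refl v)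
    rw [meetClusterCount_eq, h1]
    congr 1
    ext r
    constructor
    · rintro ⟨u, hu, rfl⟩
      exact ⟨⟨u, hu⟩, rfl⟩
    · rintro ⟨a, rfl⟩
      exact ⟨a, a.2, rfl⟩
  have hkm : Measurable[outsideEvents d Λ]
      fun ξ => meetClusterCount ((↑η : Set (Sym2 (Site d))) ∪ (ξ \ U)) ↑Λ := by
    have : (fun ξ => meetClusterCount ((↑η : Set (Sym2 (Site d))) ∪ (ξ \ U)) ↑Λ) =
        (fun ψ : ↥Λ → ↥Λ → Prop => (Set.range ψ).ncard) ∘ Ψ := funext fun ξ => hk ξ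
    rw [this]
    exact (measurable_of_countable _).comp hΨm
  have : (fun ξ : BondConfig (Site d) => rcCondWeight p q Λ ξ η) = fun ξ =>
      p ^ η.card * (1 - p) ^ (edgesIn (zdGraph d) Λ \ η).card *
        (fun n : ℕ => q ^ n) (meetClusterCount ((↑η : Set (Sym2 (Site d))) ∪ (ξ \ U)) ↑Λ) :=
    funext fun ξ => rcCondWeight_eq p q Λ ξ η
  rw [this]
  exact measurable_const.mul ((measurable_of_countable fun n : ℕ => q ^ n).comp hkm)

/-- **`ξ ↦ φ^ξ_{Λ,p,q}(ω ∩ E_Λ = η)` is `𝒯_Λ`-measurable.** [cite: Grimmett2006, §4.4 (4.30)] -/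
theorem measurable_rcCondProb_outsideEvents (p q : ℝ) (Λ : Finset (Site d)) (η : Finset (Sym2 (Site d))) :
    Measurable[outsideEvents d Λ] fun ξ : BondConfig (Site d) => rcCondProb p q Λ ξ η := by
  have : (fun ξ : BondConfig (Site d) => rcCondProb p q Λ ξ η) = fun ξ =>
      rcCondWeight p q Λ ξ η / ∑ η' ∈ (edgesIn (zdGraph d) Λ).powerset, rcCondWeight p q Λ ξ η' :=
    funext fun ξ => by rw [rcCondProb_eq, rcCondPartition_eq]
  rw [this]
  refine (measurable_rcCondWeight_outsideEvents p q Λ η).div ?_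
  exact Finset.measurable_sum _ fun η' _ => measurable_rcCondWeight_outsideEvents p q Λ η'

/-- `𝒯_Λ` is a sub-σ-algebra of the cylinder σ-algebra. [cite: Grimmett2006, §4.4] -/
theorem outsideEvents_le (Λ : Finset (Site d)) :
    outsideEvents d Λ ≤ (inferInstance : MeasurableSpace (BondConfig (Site d))) :=
  cylinderEvents_le_pi

/-- `ξ ↦ φ^ξ_{Λ,p,q}(ω ∩ E_Λ = η)` is measurable. [cite: Grimmett2006, §4.4 (4.30)] -/
theorem measurable_rcCondProb (p q : ℝ) (Λ : Finset (Site d)) (η : Finset (Sym2 (Site d))) :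
    Measurable fun ξ : BondConfig (Site d) => rcCondProb p q Λ ξ η :=
  (measurable_rcCondProb_outsideEvents p q Λ η).mono (outsideEvents_le Λ) le_rfl

end Measurability

end Summit.CriticalPhenomena.PercolationContinuityZ3.Theorems.FK

end
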